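import Literature.NumberTheory.EllipticCurves.RingClassFieldDecompositionLaw
import Summits.BirchSwinnertonDyer.Rank1Residual.X11b.RingClassFieldConj
import Summits.BirchSwinnertonDyer.Rank1Residual.X11b.KolyvaginRingClassCyclic
import Mathlib.NumberTheory.RamificationInertia.Galois
import Mathlib.FieldTheory.Galois.IsGaloisGroup
import Mathlib.RingTheory.Flat.TorsionFree
import HarnessLib

/-!
# `stub_auxiliaryInertLevelAtThree`, Galois side: the stabiliser of a prime of `K[ℓm]` in
# `G_ℓ = Gal(K[ℓm]/K[m])` has order `ord[𝔭_v]_{ℓm} / ord[𝔭_v]_m` (Gross 1991 §3; Neukirch VI (7.3))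

Crux `stmt-BirchSwinnertonDyer-19109` (`EulerHalvesAtThree`), line `inert` (tam3-p1 g18, skeleton r17/r18),
registered stub `stub_auxiliaryInertLevelAtThree` (= bsd-idea-9 g8's `AuxiliaryInertLevel W K ι 3 q N`): for a
guarded level `m₀` one asks for an auxiliary inert prime `ℓ₀` such that every generator `σ` of
`G_{ℓ₀} = Gal(K[ℓ₀m₀]/K[m₀]) = ringClassGalOver ι (ℓ₀m₀) m₀` has `σ^{ℓ₀+1} = 1` and `3^e` divides the order
of the stabiliser in `⟨σ⟩` of every prime `w̃ ∋ q` of `K[ℓ₀m₀]`.  This file settles the GALOIS-THEORETIC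
half of that stub, reducing it to a statement about orders in the ring class groups
`I_K(f)/P_{K,ℤ}(f)` (`RingClass.RingClassGroup K f`), which is where the Chebotarev choice of `ℓ₀` lives:

* `pow_succ_eq_one_of_zpowers_eq_ringClassGalOver` — **`σ^{ℓ+1} = 1`** for `zpowers σ = G_ℓ`
  (`K` imaginary quadratic, `ℓ ∤ m` an inert prime; x11b3's `pow_succ_eq_one_of_mem_ringClassGalOver`,
  Gross §3 *"`G_ℓ ≃ F_λ^×/F_ℓ^×` cyclic of order `ℓ+1`"*, divisibility form — no hypothesis on `d_K`);
* `card_stabilizer_mul_orderOf_primeClass_eq` — for `m ∣ n`, `H = ringClassGalOver ι n m` and a prime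
  `P ∣ v` of `K[n]`, `v ∤ n`: **`#Stab_H(P) · ord[𝔭_v]_m = ord[𝔭_v]_n`**.  Proof: `H` is the fixing
  subgroup in `Aut_ℚ(K[n])` of (the image of) `K[m] ⊆ K[n]` (`ringClassField_mono`,
  `RingClassField.inclusion`), hence a Galois group for `K[n]/K[m]` (Mathlib `IsGaloisGroup.of_isScalarTower`,
  `K[n]/ℚ` Galois by x11b3's `isGalois_rat_ringClassField`) and for `𝓞_{K[n]}/𝓞_{K[m]}`
  (`IsGaloisGroup.of_isFractionRing`); Mathlib's `Ideal.card_stabilizer_eq` gives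
  `#Stab_H(P) = e(P|p) f(P|p)`, `p = P ∩ 𝓞_{K[m]}`; `e(P|p) = 1` as `e(P|v) = 1`
  (`ramificationIdx_ringClassField_eq_one`, `Ideal.ramificationIdx_tower`); and
  `f(P|p) · ord[𝔭_v]_m = ord[𝔭_v]_n` is er5-w4's relative decomposition law
  `inertiaDeg_mul_orderOf_primeClass_eq_of_tower` (Neukirch VI (7.3) at the two levels);
* `dvd_card_stabilizer_of_mul_orderOf_dvd` — hence `d · ord[𝔭_v]_m ∣ ord[𝔭_v]_n ⟹ d ∣ #Stab_H(P)`;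
* `exists_heightOneSpectrum_liesOver_of_natCast_mem` — plumbing: a prime `w̃ ∋ q` of `𝓞_L` (`q` a
  rational prime coprime to `n`) lies over a prime `v ∋ q` of `𝓞_K` with `v ∤ n`;
* `auxiliaryInertLevel_conclusion_of_orderOf_dvd` — the stub's conclusion for a GIVEN `ℓ₀`
  (`σ^{ℓ₀+1} = 1 ∧ ∀ w̃ ∋ q, 3^e ∣ #Stab_{⟨σ⟩}(w̃)` for every `σ` with `zpowers σ = G_{ℓ₀}`) from the
  ideal-class hypothesis `∀ v ∋ q, 3^e · ord[𝔭_v]_{m₀} ∣ ord[𝔭_v]_{ℓ₀m₀}`.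

What remains of the stub after this file (NOT claimed here): the EXISTENCE of an inert prime `ℓ₀ ∤ N m₀`
with `3 ∤ a_{ℓ₀}(E)` and `3^e · ord[𝔮]_{m₀} ∣ ord[𝔮]_{ℓ₀m₀}` for the primes `𝔮 ∣ q` — Chebotarev in
`K(μ_{3^{e'}}, E[3], β^{1/3}, β̄^{1/3})/ℚ` plus the kernel computation
`ker(Cl(ℓ₀m₀) → Cl(m₀)) ≃ F_{ℓ₀²}^×/F_{ℓ₀}^×` (tree: `RingClass.ker_restrict_eq_range`, `card_ker_restrict`).
HONEST FRAMING: helper lemmas toward one registered stub of one line of crux 19109; the crux stays open;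
BSD is proved for no curve here.

## References

* B. H. Gross, *Kolyvagin's work on modular elliptic curves*, LMS LNS 153 (1991), §3 (pp. 238–239:
  the tower `K_n ⊇ K_m`, `G_ℓ ≃ F_λ^×/F_ℓ^×` cyclic of order `ℓ + 1`). [GrossLMS1991]
* J. Neukirch, *Algebraic Number Theory* (1999), Ch. I §9 (9.4) (decomposition group, `#G_P = e f`),
  Ch. VI §7 Thm. (7.3) (decomposition law). [NeukirchANT1999]
* D. A. Cox, *Primes of the form x² + ny²*, 2nd ed. (2013), §7.D Thm. 7.24, §9.A. [Cox2013]

## Mathlib / tree search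

Tree (imported, reused by name): `ringClassGalOver` (`HeegnerPointsOfConductor`); `ringClassField_mono`,
`RingClassField.inclusion`, `RingClassField.coe_inclusion`, `finiteDimensional_and_isGalois_ringClassField`
(`RingClassFieldTower` & deps); `inertiaDeg_mul_orderOf_primeClass_eq_of_tower`,
`ramificationIdx_ringClassField_eq_one` (`RingClassFieldDecompositionLaw`, er5-w4 p638696);
`RingClassConj.isGalois_rat_ringClassField` (`X11b/RingClassFieldConj`);
`RingClassTower.pow_succ_eq_one_of_mem_ringClassGalOver` (`X11b/KolyvaginRingClassCyclic`).
Mathlib: `Ideal.card_stabilizer_eq`, `Ideal.ramificationIdxIn_eq_ramificationIdx`,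
`Ideal.inertiaDegIn_eq_inertiaDeg`, `Ideal.ramificationIdx_tower`, `IsGaloisGroup.of_isScalarTower`,
`IsGaloisGroup.of_mulEquiv`, `IsGaloisGroup.of_isFractionRing`, `IsIntegralClosure.finite`,
`Module.Flat` over a Dedekind domain (`RingTheory/Flat/TorsionFree`), `MulEquiv.subgroupCongr`.
`lean search 'card.*stabilizer.*ringClass|stabilizer.*primeClass'` (2026-08-28): no prior statement.
-/

noncomputable section

set_option autoImplicit false
set_option linter.dupNamespace false

open IsDedekindDomain IsDedekindDomain.HeightOneSpectrum Module
open scoped NumberField Pointwise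

namespace Summit.BirchSwinnertonDyer.BirchSwinnertonDyer.Theorems.AuxInertLevel

open Literature.NumberTheory.EllipticCurves
open Literature.NumberTheory.NumberFields Literature.NumberTheory.NumberFields.RingClassField
open Literature.NumberTheory.QuadraticFields.RingClass
open Summit.BirchSwinnertonDyer.Rank1Residual.X11b

variable {K : Type} [Field K] [NumberField K]

/-! ## §1 `σ^{ℓ+1} = 1` for a generator of `G_ℓ = Gal(K[ℓm]/K[m])` -/

/-- **`σ^{ℓ+1} = 1`** for every `σ` with `zpowers σ = ringClassGalOver ι (ℓm) m` (indeed for every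
`σ ∈ G_ℓ`): `K` imaginary quadratic, `ℓ` a prime inert in `K`, `ℓ ∤ m`, `m ≥ 1` — Gross 1991 §3, *"the
subgroups `G_ℓ ≃ F_λ^×/F_ℓ^×` are cyclic of order `ℓ + 1`"* (the divisibility `#G_ℓ ∣ ℓ + 1`, x11b3's
`pow_succ_eq_one_of_mem_ringClassGalOver`, re-indexed from `(n, n/ℓ)` to `(ℓm, m)`).
[cite: GrossLMS1991, §3 (p. 239, G_ℓ cyclic of order ℓ+1)] -/
theorem pow_succ_eq_one_of_zpowers_eq_ringClassGalOver (hK : IsImaginaryQuadratic K) (ι : K →+* ℂ)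
    {ℓ m : ℕ} (hℓ : ℓ.Prime) (hℓP : (Ideal.span {(ℓ : 𝓞 K)}).IsPrime) (hℓm : ¬ ℓ ∣ m) (hm : m ≠ 0)
    {σ : ringClassField K ι (ℓ * m) ≃ₐ[ℚ] ringClassField K ι (ℓ * m)}
    (hσ : Subgroup.zpowers σ = ringClassGalOver ι (ℓ * m) m) : σ ^ (ℓ + 1) = 1 := by
  have hdiv : ℓ * m / ℓ = m := Nat.mul_div_cancel_left m hℓ.pos
  have hmem : σ ∈ ringClassGalOver ι (ℓ * m) (ℓ * m / ℓ) := by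
    rw [hdiv, ← hσ]
    exact Subgroup.mem_zpowers σ
  exact RingClassTower.pow_succ_eq_one_of_mem_ringClassGalOver hK ι (mul_ne_zero hℓ.ne_zero hm) hℓ
    (dvd_mul_right ℓ m) (by rw [hdiv]; exact hℓm) hℓP hmem

/-! ## §2 The stabiliser of a prime of `K[n]` in `Gal(K[n]/K[m])` and the ring class orders -/

/-- **`#Stab_{Gal(K[n]/K[m])}(P) · ord[𝔭_v]_m = ord[𝔭_v]_n`** (`K` imaginary quadratic, `m ∣ n`, `n ≥ 1`,
`H = ringClassGalOver ι n m ≤ Aut_ℚ(K[n])`, `P` a prime of `K[n]` above a prime `v ∤ n` of `K`): the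
stabiliser of `P` in `H = Gal(K[n]/K[m])` is the decomposition group of `P` over `p = P ∩ K[m]`, of
order `e(P|p) f(P|p)` (Neukirch I (9.4); Mathlib `Ideal.card_stabilizer_eq`) with `e(P|p) = 1`
(`K[n]/K` unramified at `v ∤ n`, Cox §9.A) and `f(P|p) = ord[𝔭_v]_n / ord[𝔭_v]_m` (the decomposition law
of the ring class fields, Neukirch VI (7.3), at the two levels: er5-w4's
`inertiaDeg_mul_orderOf_primeClass_eq_of_tower`).
[cite: NeukirchANT1999, Ch. I §9 Prop. (9.4); Ch. VI §7 Thm. (7.3)] [cite: GrossLMS1991, §3 (pp. 238–239)] -/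
theorem card_stabilizer_mul_orderOf_primeClass_eq (hK : IsImaginaryQuadratic K) (ι : K →+* ℂ)
    {m n : ℕ} (hmn : m ∣ n) (hn : n ≠ 0)
    (H : Subgroup (ringClassField K ι n ≃ₐ[ℚ] ringClassField K ι n))
    (hH : H = ringClassGalOver ι n m)
    {v : HeightOneSpectrum (𝓞 K)} (hv : ¬ Ideal.span {(n : 𝓞 K)} ≤ v.asIdeal)
    (P : Ideal (𝓞 (ringClassField K ι n))) [P.IsPrime] [P.LiesOver v.asIdeal] :
    Nat.card (MulAction.stabilizer H P) * orderOf (primeClass m v) = orderOf (primeClass n v) := by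
  classical
  have hm : m ≠ 0 := ne_zero_of_dvd_ne_zero hn hmn
  haveI := (finiteDimensional_and_isGalois_ringClassField hK ι hn).1
  haveI := (finiteDimensional_and_isGalois_ringClassField hK ι hm).1
  haveI : NumberField (ringClassField K ι n) := NumberField.of_module_finite K _
  haveI : NumberField (ringClassField K ι m) := NumberField.of_module_finite K _
  haveI : IsGalois ℚ (ringClassField K ι n) := RingClassConj.isGalois_rat_ringClassField hK ι hn
  have hle : ringClassField K ι m ≤ ringClassField K ι n := ringClassField_mono hK ι hmn hn
  -- `K[n]` as a `K[m]`-algebra through the inclusion `K[m] ⊆ K[n] ⊂ ℂ`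
  letI : Algebra (ringClassField K ι m) (ringClassField K ι n) :=
    (RingClassField.inclusion ι hle).toRingHom.toAlgebra
  haveI : IsScalarTower K (ringClassField K ι m) (ringClassField K ι n) :=
    IsScalarTower.of_algebraMap_eq fun k => ((RingClassField.inclusion ι hle).commutes k).symm
  haveI : IsScalarTower ℚ (ringClassField K ι m) (ringClassField K ι n) :=
    IsScalarTower.of_algebraMap_eq' (Subsingleton.elim _ _)
  -- `H` is the fixing subgroup of the image of `K[m]`
  have hrange : Set.range (algebraMap (ringClassField K ι m) (ringClassField K ι n)) =
      {x : ringClassField K ι n | (x : ℂ) ∈ ringClassField K ι m} := by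
    ext x
    constructor
    · rintro ⟨y, rfl⟩
      change ((RingClassField.inclusion ι hle y : ringClassField K ι n) : ℂ) ∈ ringClassField K ι m
      rw [RingClassField.coe_inclusion]
      exact y.2
    · intro hx
      exact ⟨⟨(x : ℂ), hx⟩, Subtype.ext (RingClassField.coe_inclusion ι hle _)⟩
  have hH' : fixingSubgroup (ringClassField K ι n ≃ₐ[ℚ] ringClassField K ι n)
      (Set.range (algebraMap (ringClassField K ι m) (ringClassField K ι n))) = H := by
    rw [hH, hrange]; rfl
  -- so `H` is a Galois group for `K[n]/K[m]`, hence for `𝓞 K[n] / 𝓞 K[m]`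
  haveI : IsGaloisGroup (fixingSubgroup (ringClassField K ι n ≃ₐ[ℚ] ringClassField K ι n)
      (Set.range (algebraMap (ringClassField K ι m) (ringClassField K ι n))))
      (ringClassField K ι m) (ringClassField K ι n) :=
    IsGaloisGroup.of_isScalarTower _ ℚ (ringClassField K ι n) (ringClassField K ι m)
  haveI : IsGaloisGroup H (ringClassField K ι m) (ringClassField K ι n) :=
    IsGaloisGroup.of_mulEquiv (MulEquiv.subgroupCongr hH'.symm) fun _ _ => rfl
  haveI : IsGaloisGroup H (𝓞 (ringClassField K ι m)) (𝓞 (ringClassField K ι n)) :=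
    IsGaloisGroup.of_isFractionRing _ _ _ (ringClassField K ι m) (ringClassField K ι n)
  haveI : Module.Finite (𝓞 (ringClassField K ι m)) (𝓞 (ringClassField K ι n)) :=
    IsIntegralClosure.finite (𝓞 (ringClassField K ι m)) (ringClassField K ι m)
      (ringClassField K ι n) (𝓞 (ringClassField K ι n))
  -- the primes `v ⊆ p = P ∩ 𝓞 K[m] ⊆ P`
  haveI : P.LiesOver (P.under (𝓞 (ringClassField K ι m))) := ⟨rfl⟩
  haveI := v.isMaximal
  have hPne : P ≠ ⊥ := Ideal.ne_bot_of_liesOver_of_ne_bot v.ne_bot P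
  haveI : P.IsMaximal := Ideal.IsPrime.isMaximal inferInstance hPne
  haveI : (P.under (𝓞 (ringClassField K ι m))).IsMaximal := Ideal.IsMaximal.under _ _
  haveI : (P.under (𝓞 (ringClassField K ι m))).LiesOver v.asIdeal := by
    constructor
    rw [Ideal.under_under]
    exact Ideal.LiesOver.over
  -- `#Stab_H(P) = e(P|p) f(P|p)`
  have hcard : Nat.card (MulAction.stabilizer H P) =
      (P.under (𝓞 (ringClassField K ι m))).ramificationIdxIn (𝓞 (ringClassField K ι n)) *
        (P.under (𝓞 (ringClassField K ι m))).inertiaDegIn (𝓞 (ringClassField K ι n)) :=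
    Ideal.card_stabilizer_eq (G := H) (P.under (𝓞 (ringClassField K ι m))) P
  -- `f(P|p) · ord[𝔭_v]_m = ord[𝔭_v]_n`
  have htower := inertiaDeg_mul_orderOf_primeClass_eq_of_tower hK ι hmn hn hv
    (P.under (𝓞 (ringClassField K ι m))) P
  -- `e(P|p) = 1` from `e(P|v) = e(p|v) e(P|p) = 1`
  have he1 : P.ramificationIdx (𝓞 K) = 1 := ramificationIdx_ringClassField_eq_one hK ι hn hv P
  have he : P.ramificationIdx (𝓞 (ringClassField K ι m)) = 1 := by
    rw [Ideal.ramificationIdx_tower (P.under (𝓞 (ringClassField K ι m))) P] at he1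
    exact Nat.eq_one_of_mul_eq_one_left he1
  rw [hcard, Ideal.ramificationIdxIn_eq_ramificationIdx (P.under (𝓞 (ringClassField K ι m))) P H,
    Ideal.inertiaDegIn_eq_inertiaDeg (P.under (𝓞 (ringClassField K ι m))) P H, he, one_mul]
  exact htower

/-- **`d · ord[𝔭_v]_m ∣ ord[𝔭_v]_n ⟹ d ∣ #Stab_{Gal(K[n]/K[m])}(P)`** (same hypotheses): the form in
which `stub_auxiliaryInertLevelAtThree` consumes the order computation (`d = 3^e`).
[cite: NeukirchANT1999, Ch. VI §7 Thm. (7.3)] [cite: GrossLMS1991, §3 (pp. 238–239)] -/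
theorem dvd_card_stabilizer_of_mul_orderOf_dvd (hK : IsImaginaryQuadratic K) (ι : K →+* ℂ)
    {m n : ℕ} (hmn : m ∣ n) (hn : n ≠ 0)
    (H : Subgroup (ringClassField K ι n ≃ₐ[ℚ] ringClassField K ι n))
    (hH : H = ringClassGalOver ι n m)
    {v : HeightOneSpectrum (𝓞 K)} (hv : ¬ Ideal.span {(n : 𝓞 K)} ≤ v.asIdeal)
    (P : Ideal (𝓞 (ringClassField K ι n))) [P.IsPrime] [P.LiesOver v.asIdeal] {d : ℕ}
    (hd : d * orderOf (primeClass m v) ∣ orderOf (primeClass n v)) :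
    d ∣ Nat.card (MulAction.stabilizer H P) := by
  have hm : m ≠ 0 := ne_zero_of_dvd_ne_zero hn hmn
  haveI : Finite (RingClassGroup K m) := finite_ringClassGroup (K := K) (f := m) hK.1 hm
  have hpos : 0 < orderOf (primeClass m v) := orderOf_pos (primeClass m v)
  rw [← card_stabilizer_mul_orderOf_primeClass_eq hK ι hmn hn H hH hv P] at hd
  exact (Nat.mul_dvd_mul_iff_right hpos).mp hd

/-! ## §3 The stub's conclusion for a given auxiliary prime `ℓ₀` -/

omit [NumberField K] in
/-- Plumbing: a prime `w̃` of `𝓞_L` containing the rational prime `q`, `gcd(q, n) = 1`, lies over the prime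
`v = w̃ ∩ 𝓞_K` of `𝓞_K`, which contains `q` and does not contain `n` (else `1 = aq + bn ∈ v`). [folklore] -/
theorem exists_heightOneSpectrum_liesOver_of_natCast_mem [NumberField K] {L : Type*} [Field L]
    [Algebra K L] {q n : ℕ} (hq : q.Prime) (hqn : q.Coprime n)
    (w : HeightOneSpectrum (𝓞 L)) (hqw : ((q : ℕ) : 𝓞 L) ∈ w.asIdeal) :
    ∃ v : HeightOneSpectrum (𝓞 K), w.asIdeal.LiesOver v.asIdeal ∧ ((q : ℕ) : 𝓞 K) ∈ v.asIdeal ∧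
      ¬ Ideal.span {(n : 𝓞 K)} ≤ v.asIdeal := by
  have hqK : ((q : ℕ) : 𝓞 K) ∈ w.asIdeal.under (𝓞 K) := by
    rw [Ideal.under_def, Ideal.mem_comap, map_natCast]
    exact hqw
  have hne : w.asIdeal.under (𝓞 K) ≠ ⊥ := fun h => by
    rw [h, Ideal.mem_bot, Nat.cast_eq_zero] at hqK
    exact hq.ne_zero hqK
  refine ⟨⟨w.asIdeal.under (𝓞 K), inferInstance, hne⟩, ⟨rfl⟩, hqK, fun hle => ?_⟩
  have hnK : ((n : ℕ) : 𝓞 K) ∈ w.asIdeal.under (𝓞 K) := hle (Ideal.mem_span_singleton_self _)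
  obtain ⟨a, b, hab⟩ := (Nat.isCoprime_iff_coprime.mpr hqn : IsCoprime (q : ℤ) (n : ℤ))
  have hone : (1 : 𝓞 K) ∈ w.asIdeal.under (𝓞 K) := by
    have h := congrArg (fun z : ℤ => (z : 𝓞 K)) hab
    simp only [Int.cast_add, Int.cast_mul, Int.cast_natCast, Int.cast_one] at h
    rw [← h]
    exact Ideal.add_mem _ (Ideal.mul_mem_left _ _ hqK) (Ideal.mul_mem_left _ _ hnK)
  exact (Ideal.IsPrime.under (𝓞 K) w.asIdeal).ne_top ((Ideal.eq_top_iff_one _).mpr hone)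

/-- **`stub_auxiliaryInertLevelAtThree` for a GIVEN auxiliary prime, from the ring class orders.**  Let `K`
be imaginary quadratic, `ℓ` an inert prime, `ℓ ∤ m`, `m ≥ 1`, `q` a prime with `gcd(q, ℓm) = 1`, and suppose
that for every prime `v ∋ q` of `K`, `3^e · ord[𝔭_v]_m ∣ ord[𝔭_v]_{ℓm}` in the ring class groups
`I_K(·)/P_{K,ℤ}(·)`.  Then every `σ ∈ Aut_ℚ(K[ℓm])` with `zpowers σ = G_ℓ = Gal(K[ℓm]/K[m])` has
`σ^{ℓ+1} = 1`, and `3^e ∣ #Stab_{⟨σ⟩}(w̃)` for every prime `w̃ ∋ q` of `K[ℓm]` — VERBATIM the two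
conclusions of the registered stub (whose remaining content is the Chebotarev CHOICE of `ℓ = ℓ₀` making the
order hypothesis true). [cite: GrossLMS1991, §3 (pp. 238–239)] [cite: NeukirchANT1999, Ch. VI §7 Thm. (7.3)] -/
theorem auxiliaryInertLevel_conclusion_of_orderOf_dvd (hK : IsImaginaryQuadratic K) (ι : K →+* ℂ)
    {ℓ m : ℕ} (hℓ : ℓ.Prime) (hℓP : (Ideal.span {(ℓ : 𝓞 K)}).IsPrime) (hℓm : ¬ ℓ ∣ m) (hm : m ≠ 0)
    {q : ℕ} (hq : q.Prime) (hqn : q.Coprime (ℓ * m)) {e : ℕ}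
    (hord : ∀ v : HeightOneSpectrum (𝓞 K), ((q : ℕ) : 𝓞 K) ∈ v.asIdeal →
      3 ^ e * orderOf (primeClass m v) ∣ orderOf (primeClass (ℓ * m) v))
    (σ : ringClassField K ι (ℓ * m) ≃ₐ[ℚ] ringClassField K ι (ℓ * m))
    (hσ : Subgroup.zpowers σ = ringClassGalOver ι (ℓ * m) m) :
    σ ^ (ℓ + 1) = 1 ∧
      ∀ w : HeightOneSpectrum (𝓞 (ringClassField K ι (ℓ * m))),
        ((q : ℕ) : 𝓞 (ringClassField K ι (ℓ * m))) ∈ w.asIdeal →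
        3 ^ e ∣ Nat.card (MulAction.stabilizer (Subgroup.zpowers σ) w.asIdeal) := by
  refine ⟨pow_succ_eq_one_of_zpowers_eq_ringClassGalOver hK ι hℓ hℓP hℓm hm hσ, fun w hqw => ?_⟩
  obtain ⟨v, hwv, hqv, hv⟩ := exists_heightOneSpectrum_liesOver_of_natCast_mem (K := K) hq hqn w hqw
  haveI := hwv
  exact dvd_card_stabilizer_of_mul_orderOf_dvd hK ι (dvd_mul_left m ℓ) (mul_ne_zero hℓ.ne_zero hm)
    (Subgroup.zpowers σ) hσ hv w.asIdeal (hord v hqv)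

end Summit.BirchSwinnertonDyer.BirchSwinnertonDyer.Theorems.AuxInertLevel

end
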